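import Mathlib
import Summits.CriticalPhenomena.CardyFormulaZ2.Theorems.CardySelfRefinementDefs
import Summits.CriticalPhenomena.CardyFormulaZ2.Theorems.CardySelfRefinementGradientComparabilityStubSlopeBoundsCornerPendant
import Summits.CriticalPhenomena.CardyFormulaZ2.Theorems.CardySelfRefinementGradientComparabilityStubNonAxialShareBulkLocal
import HarnessLib

/-!
# Crux `GradientComparability` (stmt-CriticalPhenomena-10269), line `monotone-product-coordinates` —
# stub `stub_cornerLocalSlope` (LOC), corner transfer (B″), part 1: the deterministic core —
# a pivotal interior edge has an open neighbour, a local patch replaces it, and set-pivotality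
# propagates along a chain of forced-open bundles

Route `CardySelfRefinement`, sub-problem `CriticalPhenomena/CardyFormulaZ2`; vocabulary from
`CardySelfRefinementDefs` (`Aloc window`); the pendant lemma `sdiff_mem_Aloc_of_pendant`
(`…StubSlopeBoundsCornerPendant`) and the closure-semantics kit of `…StubNonAxialShareBulk{Topology,
Reroute,Surgery,Frames,Local}` (`crossing_reroute`, `crossing_of_subset_union_of_disjoint`,
`ball_subset_interior_or_disjoint`, `exists_vertex_of_mem_inter`, `eta_mul_z_eq_meshPoint`,
`mem_configOf_iff_exists_isCrossing_openEdgeUnion`).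

## Mathematics

The corner transfer (B″) of the local corner slope bound charges every pivotal INTERIOR
(non-axial) edge `e` of a far cell to the set-pivotality
`PIV_B(ω') = {ω' ∪ B ∈ Aloc ∧ ω' ∖ B ∉ Aloc}` of a side bundle `B` of the cell, in a configuration
`ω'` obtained from `ω ∖ {e}` by forcing at most three other side bundles open (cost `2^{k+1}` each,
`real_union_bundle_mem_le`, uniform in `ρ`).  Its deterministic core consists of three
configuration-wise facts, valid for every `k` and every quad family (`m ≥ 1`, the JOINT event):

* `exists_adj_mem_of_isPivotal` — if `e = {w, μ}` is pivotal for `Aloc` in `ω` and the drawn `w`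
  is far from the quad sides, some OTHER lattice edge at `w` is open in `ω` (a pendant edge is
  never pivotal);
* `mem_Aloc_of_local_patch` — if `ρ ∈ Aloc`, `ρ ⊆ ρ' ∪ {e}`, `e ∉ ρ'`, and `ρ'` contains a set `L`
  of lattice edges near `w` whose drawing is connected and contains the drawn ends of `e`, then
  `ρ' ∈ Aloc`: for every quad containing the far ball the crossing is rerouted through the drawing
  of `L` (`crossing_reroute`), for the others the edge `e` is drawn off the carrier;
* `setPivotal_chain4` (registered) — pure set theory for an increasing `E`: if `ω ∉ E` and
  `ω ∪ B₁ ∪ B₂ ∪ B₃ ∪ B₄ ∈ E`, then `B_j` is set-pivotal at `ω ∪ B₁ ∪ ⋯ ∪ B_{j−1}` for some `j ≤ 4`.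

Part 2 (`…StubSlopeBoundsCornerTransferCell`) supplies, for `k = 2`, the patch `L` = an open spoke
of the cell plus six boundary sub-edges, and concludes the pointwise corner transfer; part 3 the
measure bound `M(e pivotal) ≤ 585/(1−c) · Σ_{sides B} M(PIV_B)`.
-/

noncomputable section

namespace Summit.CriticalPhenomena.CardyFormulaZ2.Theorems.CardySelfRefinement

open scoped Topology
open Filter Set MeasureTheory
open Literature.Probability.LatticeModels Literature.Probability.Percolation
open Literature.Probability.Percolation.QuadCrossing
open Summit.CriticalPhenomena.CardyFormulaZ2.Theses.CardySelfRefinement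

/-! ## A pivotal edge far from the sides has an open neighbour -/

/-- **A pivotal far edge is not pendant.**  If `{w, μ}` is pivotal for `Aloc m F η` in `ω` and the
drawn `w` is at distance `≥ r ≥ 2η` from every side of every quad, then some lattice edge `{w, y}`
with `y ≠ μ` is open in `ω` (contrapositive of `sdiff_mem_Aloc_of_pendant`). -/
theorem exists_adj_mem_of_isPivotal (m : ℕ) (F : Fin m → Quad (Set.univ : Set ℂ)) {η r : ℝ}
    (hη : 0 < η) (hηr : 2 * η ≤ r) {ω : BondConfig (Site 2)} {w μ : Site 2}
    (hwμ : (zdGraph 2).Adj w μ)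
    (hfar : ∀ (i : Fin m) (j : Fin 4), ∀ p ∈ (F i).side j,
      r ≤ dist ((η : ℂ) * squareLatticeEmbedding.z w) p)
    (hpiv : IsPivotal (Aloc m F η) s(w, μ) ω) :
    ∃ y, (zdGraph 2).Adj w y ∧ s(w, y) ∈ ω ∧ y ≠ μ := by
  by_contra hno
  push Not at hno
  have h1 : insert s(w, μ) ω ∈ Aloc m F η ∧ ω \ {s(w, μ)} ∉ Aloc m F η := by
    rcases hpiv with ⟨ha, hb⟩ | ⟨ha, hb⟩
    · exact ⟨ha, hb⟩
    · exact absurd (isUpperSet_Aloc m F η (Set.sdiff_subset.trans (Set.subset_insert _ ω)) ha) hb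
  have hin : insert s(μ, w) ω ∈ Aloc m F η := by rw [Sym2.eq_swap]; exact h1.1
  have h := sdiff_mem_Aloc_of_pendant m F hη hηr hwμ.symm hno hfar hin
  rw [Sym2.eq_swap] at h
  exact h1.2 h

/-! ## Replacing a far edge by a local patch keeps the localised joint crossing event -/

/-- **Local patch.**  Let `{w, μ}` be a lattice edge with the drawn `w` at distance `≥ r ≥ 20η` from
every side of every quad, `ρ ∈ Aloc m F η`, `ρ ⊆ ρ' ∪ {wμ}`, `wμ ∉ ρ'`, and let `L ⊆ ρ'` be a set of
lattice edges based within four steps of `w` whose drawing (mesh `η√2`) is preconnected and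
contains the drawn `w` and the drawn `μ`.  Then `ρ' ∈ Aloc m F η`: a quad whose carrier contains the
`r`-ball about the drawn `w` has its crossing rerouted through the drawing of `L`
(`crossing_reroute`: the drawings of `ρ'` and `{wμ}` meet only at the drawn ends), a quad whose
carrier misses the ball does not see the edge at all. -/
theorem mem_Aloc_of_local_patch (m : ℕ) (F : Fin m → Quad (Set.univ : Set ℂ)) {η r : ℝ}
    (hη : 0 < η) (hηr : 20 * η ≤ r) {w μ : Site 2} (hwμ : (zdGraph 2).Adj w μ)
    (hfar : ∀ (i : Fin m) (j : Fin 4), ∀ p ∈ (F i).side j,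
      r ≤ dist ((η : ℂ) * squareLatticeEmbedding.z w) p)
    {ρ ρ' L : BondConfig (Site 2)} (hsub : ρ ⊆ ρ' ∪ {s(w, μ)}) (he : s(w, μ) ∉ ρ') (hL : L ⊆ ρ')
    (hLnear : ∀ x ∈ L, ∃ a b, x = s(a, b) ∧ (zdGraph 2).Adj a b ∧ ∀ i, |a i - w i| ≤ 4)
    (hLconn : IsPreconnected (openEdgeUnion (η * Real.sqrt 2) L))
    (hwL : meshPoint (η * Real.sqrt 2) w ∈ openEdgeUnion (η * Real.sqrt 2) L)
    (hμL : meshPoint (η * Real.sqrt 2) μ ∈ openEdgeUnion (η * Real.sqrt 2) L)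
    (hin : ρ ∈ Aloc m F η) : ρ' ∈ Aloc m F η := by
  set dd : ℝ := η * Real.sqrt 2 with hdd_def
  have hdd : 0 < dd := by positivity
  have hsqrt : Real.sqrt 2 < 3 / 2 := (Real.sqrt_lt' (by norm_num)).2 (by norm_num)
  have hddr : 10 * dd < r := by rw [hdd_def]; nlinarith
  set W : Set (Sym2 (Site 2)) := window m F η with hW_def
  have hW : W ⊆ (zdGraph 2).edgeSet := Set.iUnion_subset fun i => Set.inter_subset_right
  have hρE : ρ ∩ W ⊆ (zdGraph 2).edgeSet := Set.inter_subset_right.trans hW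
  have hρ'E : ρ' ∩ W ⊆ (zdGraph 2).edgeSet := Set.inter_subset_right.trans hW
  have hin' : ∀ i, F i ∈ configOf squareLatticeEmbedding.z η Set.univ (ρ ∩ W) := hin
  have hinK : ∀ i, ∃ K, (F i).IsCrossing K ∧ K ⊆ openEdgeUnion dd (ρ ∩ W) := fun i =>
    (mem_configOf_iff_exists_isCrossing_openEdgeUnion hη hρE (F i)).1 (hin' i)
  have hsub' : ρ ∩ W ⊆ ρ' ∩ W ∪ {s(w, μ)} := by
    rintro x ⟨hx, hxW⟩
    rcases hsub hx with h | h
    exacts [Or.inl ⟨h, hxW⟩, Or.inr h]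
  -- geometry: the `r`-ball about the drawn `w`
  have hfar_v : ∀ (i : Fin m) (j : Fin 4), ∀ q ∈ (F i).side j, r ≤ dist (meshPoint dd w) q :=
    fun i j q hq => by
      rw [← eta_mul_z_eq_meshPoint]
      exact hfar i j q hq
  have hball_alt : ∀ i, Metric.ball (meshPoint dd w) r ⊆ interior (F i).carrier ∨
      ∀ z ∈ Metric.ball (meshPoint dd w) r, z ∉ (F i).carrier := fun i =>
    ball_subset_interior_or_disjoint (F i) (fun j q hq => hfar_v i j q hq)
  have hnear_ball : ∀ x : Site 2, (∀ i, |x i - w i| ≤ 4) → ∀ y, (zdGraph 2).Adj x y →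
      segment ℝ (meshPoint dd x) (meshPoint dd y) ⊆ Metric.ball (meshPoint dd w) r := by
    intro x hx y hxy
    have hxv : dist (meshPoint dd x) (meshPoint dd w) ≤ dd * 8 := by
      refine (dist_meshPoint_le hdd.le x w).trans ?_
      have h0 : |((x 0 : ℤ) : ℝ) - w 0| ≤ 4 := by exact_mod_cast hx 0
      have h1 : |((x 1 : ℤ) : ℝ) - w 1| ≤ 4 := by exact_mod_cast hx 1
      nlinarith
    have hyv : dist (meshPoint dd y) (meshPoint dd w) ≤ dd * 9 := by
      have h := dist_triangle (meshPoint dd y) (meshPoint dd x) (meshPoint dd w)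
      have h' : dist (meshPoint dd y) (meshPoint dd x) ≤ dd := by
        rw [dist_comm]
        exact dist_meshPoint_le_of_mem_segment hdd hxy (right_mem_segment ℝ _ _)
      linarith
    refine (convex_ball (meshPoint dd w) r).segment_subset ?_ ?_ <;> rw [Metric.mem_ball] <;> linarith
  have hseg_e : segment ℝ (meshPoint dd w) (meshPoint dd μ) ⊆ Metric.ball (meshPoint dd w) r :=
    hnear_ball w (fun i => by simp) μ hwμ
  have he_ball : openEdgeUnion dd {s(w, μ)} ⊆ Metric.ball (meshPoint dd w) r :=
    (openEdgeUnion_singleton_subset dd w μ).trans hseg_e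
  have hL_ball : openEdgeUnion dd L ⊆ Metric.ball (meshPoint dd w) r := fun z hz => by
    obtain ⟨a, b, hab, hx, hz⟩ := mem_openEdgeUnion_iff.1 hz
    obtain ⟨a', b', hx', hab', hnr⟩ := hLnear _ hx
    have hz' : z ∈ openEdgeUnion dd {s(a', b')} := by
      rw [← hx']
      exact mem_openEdgeUnion_iff.2 ⟨a, b, hab, rfl, hz⟩
    exact hnear_ball a' hnr b' hab' (openEdgeUnion_singleton_subset dd a' b' hz')
  -- every quad stays crossed
  show ∀ i, F i ∈ configOf squareLatticeEmbedding.z η Set.univ (ρ' ∩ W)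
  intro i
  rw [mem_configOf_iff_exists_isCrossing_openEdgeUnion hη hρ'E]
  rcases hball_alt i with hI | hO
  · -- bulk quad: reroute through the drawing of `L`
    have hL_W : L ⊆ W := fun x hx => by
      obtain ⟨a, b, rfl, hab, hnr⟩ := hLnear x hx
      refine Set.mem_iUnion.2 ⟨i, ⟨a, b, rfl, ⟨meshPoint dd a, ?_, ?_⟩⟩, (SimpleGraph.mem_edgeSet _).2 hab⟩
      · rw [eta_mul_z_eq_meshPoint, eta_mul_z_eq_meshPoint]
        exact left_mem_segment ℝ _ _
      · exact Metric.self_subset_thickening (by norm_num) _ (interior_subset (hI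
          (hnear_ball a hnr b hab (left_mem_segment ℝ _ _))))
    have hLsub : openEdgeUnion dd L ⊆ openEdgeUnion dd (ρ' ∩ W) :=
      openEdgeUnion_mono dd fun x hx => ⟨hL hx, hL_W hx⟩
    refine crossing_reroute hdd (F i) hsub'
      (Metric.isCompact_of_isClosed_isBounded (isClosed_openEdgeUnion hdd L)
        (Metric.isBounded_ball.subset hL_ball))
      hLconn ((hL_ball.trans hI).trans interior_subset) hLsub (fun z hz hzR => ?_) (fun z hz => ?_) (hinK i)
    · -- the drawings of `ρ' ∩ W` and `{wμ}` meet only at the drawn ends of the edge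
      obtain ⟨x, hzx, ⟨y, -, hxe⟩, -⟩ := exists_vertex_of_mem_inter hdd (S := {s(w, μ)}) (T := ρ' ∩ W)
        (fun f hf hT => he (by rw [Set.mem_singleton_iff.1 hf] at hT; exact hT.1)) hzR hz
      rw [hzx]
      rcases eq_or_eq_of_sym2_eq (Set.mem_singleton_iff.1 hxe) with rfl | rfl
      exacts [hwL, hμL]
    · have hz' : z ∈ interior (F i).carrier := hI (he_ball hz)
      exact ⟨notMem_side_of_mem_interior (F i) hz' 0, notMem_side_of_mem_interior (F i) hz' 2⟩
  · -- far quad: the edge is drawn off the carrier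
    exact crossing_of_subset_union_of_disjoint dd (F i) hsub' (fun z hz hzQ => hO z (he_ball hz) hzQ) (hinK i)

/-! ## Set-pivotality along a chain of forced-open sets -/

/-- **Chain lemma** (registered helper of `stub_cornerLocalSlope`; the bookkeeping of the corner
transfer (B″)).  For an increasing event `E`, if `ω ∉ E` but `ω ∪ B₁ ∪ B₂ ∪ B₃ ∪ B₄ ∈ E`, then one
of the four sets is SET-PIVOTAL once the previous ones are forced open: for some `j ≤ 4`,
`(ω ∪ B₁ ∪ ⋯ ∪ B_{j−1}) ∪ B_j ∈ E` and `(ω ∪ B₁ ∪ ⋯ ∪ B_{j−1}) ∖ B_j ∉ E`. -/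
theorem setPivotal_chain4 : ∀ {α : Type*} {E : Set (Set α)}, IsUpperSet E → ∀ (ω B₁ B₂ B₃ B₄ : Set α), ω ∉ E → ω ∪ B₁ ∪ B₂ ∪ B₃ ∪ B₄ ∈ E → (ω ∪ B₁ ∈ E ∧ ω \ B₁ ∉ E) ∨ (ω ∪ B₁ ∪ B₂ ∈ E ∧ (ω ∪ B₁) \ B₂ ∉ E) ∨ (ω ∪ B₁ ∪ B₂ ∪ B₃ ∈ E ∧ (ω ∪ B₁ ∪ B₂) \ B₃ ∉ E) ∨ (ω ∪ B₁ ∪ B₂ ∪ B₃ ∪ B₄ ∈ E ∧ (ω ∪ B₁ ∪ B₂ ∪ B₃) \ B₄ ∉ E) := by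
  intro α E hE ω B₁ B₂ B₃ B₄ hout hin
  by_cases h4 : (ω ∪ B₁ ∪ B₂ ∪ B₃) \ B₄ ∈ E
  swap
  · exact Or.inr (Or.inr (Or.inr ⟨hin, h4⟩))
  have h3in : ω ∪ B₁ ∪ B₂ ∪ B₃ ∈ E := hE Set.sdiff_subset h4
  by_cases h3 : (ω ∪ B₁ ∪ B₂) \ B₃ ∈ E
  swap
  · exact Or.inr (Or.inr (Or.inl ⟨h3in, h3⟩))
  have h2in : ω ∪ B₁ ∪ B₂ ∈ E := hE Set.sdiff_subset h3
  by_cases h2 : (ω ∪ B₁) \ B₂ ∈ E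
  swap
  · exact Or.inr (Or.inl ⟨h2in, h2⟩)
  have h1in : ω ∪ B₁ ∈ E := hE Set.sdiff_subset h2
  exact Or.inl ⟨h1in, fun h => hout (hE Set.sdiff_subset h)⟩

end Summit.CriticalPhenomena.CardyFormulaZ2.Theorems.CardySelfRefinement

end
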